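import Mathlib
import Summits.Ventures.PercRepro2.HCov
import Summits.Ventures.PercRepro2.A3Fibre
import Summits.Ventures.PercRepro2.A3FibreA
import Summits.Ventures.PercRepro2.A3FibreWorlds

/-!
# The a₃-exploration reduction of (HCOV): `A3Between → HCov`
(blind cell PercRepro2, p5 g12; `proofs/P5-A3FIBRE.md` §2, S4 §2.4 (n))

The covariance form `Gc` of HCov.lean splits along the fibres `Q ∩ {C(a₃) = W}`:
`Gc = P(PD)·P(Q)·(∑ W, slack W / mW W + btw)` (`Gc_eq_a3`), where every fibre slack is
nonnegative (`A3FibreA.slack_nonneg`: BHK 1.4 on the A-fibres, Harris on the T / T′-fibres), so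
**`HCov_of_a3Between : A3Between p ends o a₁ a₂ a₃ b → HCov p ends o a₁ a₂ a₃ b`**.  The
identity is the law of total covariance over the revealed cluster of `a₃`: the twelve events of
`Gc` are partitioned by the fibres (`sum_prob_fibre_inter` and the world restrictions of
A3FibreWorlds), the world sign `s3` collects the `T` / `T′` terms (`s3_mul_eq`), and the
per-fibre identity `slack_div_add` removes the denominators.
-/

namespace Summit.Ventures.PercRepro2

open UnionCluster

namespace CovForm

namespace A3Fibre

section Assembly

variable {V : Type*} {E : Type*} [Fintype V] [DecidableEq V] [Fintype E] [DecidableEq E]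
  {R : Type*} [Field R] [LinearOrder R] [IsStrictOrderedRing R]

omit [Fintype V] [DecidableEq V] [LinearOrder R] [IsStrictOrderedRing R] in
/-- With both roots in `W` the fibre is empty, so every fibre probability vanishes. -/
lemma prob_fibre_inter_eq_zero_of_mem_mem (p : E → R) (ends : E → Sym2 V) (a₁ a₂ a₃ : V)
    {W : Finset V} (h₁ : a₁ ∈ W) (h₂ : a₂ ∈ W) (X : Set (Config E)) :
    prob p (fibre ends a₁ a₂ a₃ W ∩ X) = 0 := by
  rw [fibre_eq_empty_of_mem_mem ends a₁ a₂ a₃ h₁ h₂, Set.empty_inter, prob_empty]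

omit [Fintype V] [LinearOrder R] [IsStrictOrderedRing R] in
/-- The world sign collects the `T′` and `T` indicators (on a fibre with both roots the value
vanishes). -/
lemma s3_mul_eq (a₁ a₂ : V) (W : Finset V) (x : R) (hx : a₁ ∈ W → a₂ ∈ W → x = 0) :
    s3 a₁ a₂ W * x = (if a₁ ∈ W then x else 0) - (if a₂ ∈ W then x else 0) := by
  unfold s3
  by_cases h₁ : a₁ ∈ W <;> by_cases h₂ : a₂ ∈ W <;> simp [h₁, h₂]
  exact hx h₁ h₂

omit [LinearOrder R] [IsStrictOrderedRing R] in
/-- `P(PD) = ∑_{W ∈ A} m_W`. -/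
lemma prob_PD_eq (p : E → R) (ends : E → Sym2 V) (a₁ a₂ a₃ : V) :
    prob p (PDEvent ends a₁ a₂ a₃) =
      ∑ W : Finset V, if a₁ ∉ W ∧ a₂ ∉ W then mW p ends a₁ a₂ a₃ W else 0 := by
  have h := prob_PD_inter p ends a₁ a₂ a₃ Set.univ
  simpa only [Set.inter_univ, mW] using h

omit [LinearOrder R] [IsStrictOrderedRing R] in
/-- `D_o = ∑_{W ∈ A} Su_o W`. -/
lemma Do_eq (p : E → R) (ends : E → Sym2 V) (o a₁ a₂ a₃ : V) :
    Do p ends o a₁ a₂ a₃ =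
      ∑ W : Finset V, if a₁ ∉ W ∧ a₂ ∉ W then Su p ends a₁ a₂ a₃ o W else 0 := by
  unfold Do
  rw [prob_PD_inter, prob_PD_inter, ← Finset.sum_add_distrib]
  refine Finset.sum_congr rfl fun W _ => ?_
  unfold Su
  split_ifs <;> ring

omit [LinearOrder R] [IsStrictOrderedRing R] in
/-- `P(PD, b ∈ U) = ∑_{W ∈ A} Su_b W`. -/
lemma PDb_eq (p : E → R) (ends : E → Sym2 V) (a₁ a₂ a₃ b : V) :
    PDb p ends a₁ a₂ a₃ b =
      ∑ W : Finset V, if a₁ ∉ W ∧ a₂ ∉ W then Su p ends a₁ a₂ a₃ b W else 0 := by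
  unfold PDb
  rw [prob_PD_inter, prob_PD_inter, ← Finset.sum_add_distrib]
  refine Finset.sum_congr rfl fun W _ => ?_
  unfold Su
  split_ifs <;> ring

omit [LinearOrder R] [IsStrictOrderedRing R] in
/-- `P(PD, b ∈ U, o ∈ U) = ∑_{W ∈ A} Suu W`. -/
lemma PDbo_eq (p : E → R) (ends : E → Sym2 V) (o a₁ a₂ a₃ b : V) :
    PDbo p ends o a₁ a₂ a₃ b =
      ∑ W : Finset V, if a₁ ∉ W ∧ a₂ ∉ W then Suu p ends a₁ a₂ a₃ b o W else 0 := by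
  unfold PDbo
  rw [prob_PD_inter, prob_PD_inter, prob_PD_inter, prob_PD_inter, ← Finset.sum_add_distrib,
    ← Finset.sum_add_distrib, ← Finset.sum_add_distrib]
  refine Finset.sum_congr rfl fun W _ => ?_
  unfold Suu
  simp only [Set.inter_comm (connEvent ends a₁ o) (connEvent ends a₁ b),
    Set.inter_comm (connEvent ends a₂ o) (connEvent ends a₁ b),
    Set.inter_comm (connEvent ends a₁ o) (connEvent ends a₂ b),
    Set.inter_comm (connEvent ends a₂ o) (connEvent ends a₂ b)]
  split_ifs <;> ring

omit [LinearOrder R] [IsStrictOrderedRing R] in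
/-- `E_Q[σ_b σ_o] = ∑_W Sbo W`. -/
lemma EQbo_eq (p : E → R) (ends : E → Sym2 V) (o a₁ a₂ a₃ b : V) :
    EQbo p ends o a₁ a₂ b = ∑ W : Finset V, Sbo p ends a₁ a₂ a₃ b o W := by
  unfold EQbo
  rw [← sum_prob_fibre_inter p ends a₁ a₂ a₃, ← sum_prob_fibre_inter p ends a₁ a₂ a₃,
    ← sum_prob_fibre_inter p ends a₁ a₂ a₃, ← sum_prob_fibre_inter p ends a₁ a₂ a₃,
    ← Finset.sum_add_distrib, ← Finset.sum_sub_distrib, ← Finset.sum_sub_distrib]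
  refine Finset.sum_congr rfl fun W _ => ?_
  unfold Sbo
  simp only [Set.inter_comm (connEvent ends a₁ o) (connEvent ends a₁ b),
    Set.inter_comm (connEvent ends a₂ o) (connEvent ends a₁ b),
    Set.inter_comm (connEvent ends a₁ o) (connEvent ends a₂ b),
    Set.inter_comm (connEvent ends a₂ o) (connEvent ends a₂ b)]

omit [LinearOrder R] [IsStrictOrderedRing R] in
/-- `E_Q[σ_o] = ∑_W Ssig_o W`. -/
lemma EQo_eq (p : E → R) (ends : E → Sym2 V) (o a₁ a₂ a₃ : V) :
    EQo p ends o a₁ a₂ = ∑ W : Finset V, Ssig p ends a₁ a₂ a₃ o W := by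
  unfold EQo Ssig
  rw [← sum_prob_fibre_inter p ends a₁ a₂ a₃, ← sum_prob_fibre_inter p ends a₁ a₂ a₃,
    ← Finset.sum_sub_distrib]

/-- `gap = −∑_W Ssig_b W`. -/
lemma gap_eq_sum (p : E → R) (ends : E → Sym2 V) (a₁ a₂ a₃ b : V) :
    gap p ends a₁ a₂ b = -∑ W : Finset V, Ssig p ends a₁ a₂ a₃ b W := by
  rw [gap_eq_Q, ← sum_prob_fibre_inter p ends a₁ a₂ a₃, ← sum_prob_fibre_inter p ends a₁ a₂ a₃,
    ← Finset.sum_neg_distrib, ← Finset.sum_sub_distrib]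
  refine Finset.sum_congr rfl fun W _ => ?_
  unfold Ssig
  ring

omit [LinearOrder R] [IsStrictOrderedRing R] in
/-- `E_Q[σ_b σ₃] = ∑_W s3 W · Ssig_b W`. -/
lemma EQb3_eq (p : E → R) (ends : E → Sym2 V) (a₁ a₂ a₃ b : V) :
    EQb3 p ends a₁ a₂ a₃ b = ∑ W : Finset V, s3 a₁ a₂ W * Ssig p ends a₁ a₂ a₃ b W := by
  unfold EQb3
  rw [prob_T'_inter, prob_T_inter, prob_T_inter, prob_T'_inter, ← Finset.sum_add_distrib,
    ← Finset.sum_sub_distrib, ← Finset.sum_sub_distrib]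
  refine Finset.sum_congr rfl fun W _ => ?_
  rw [s3_mul_eq a₁ a₂ W _ (fun h₁ h₂ => by
    simp [Ssig, prob_fibre_inter_eq_zero_of_mem_mem p ends a₁ a₂ a₃ h₁ h₂])]
  unfold Ssig
  split_ifs <;> ring

omit [LinearOrder R] [IsStrictOrderedRing R] in
/-- `E_Q[σ₃] = ∑_W s3 W · m_W`. -/
lemma EQ3_eq (p : E → R) (ends : E → Sym2 V) (a₁ a₂ a₃ : V) :
    EQ3 p ends a₁ a₂ a₃ = ∑ W : Finset V, s3 a₁ a₂ W * mW p ends a₁ a₂ a₃ W := by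
  unfold EQ3
  have h1 := prob_T'_inter p ends a₁ a₂ a₃ Set.univ
  have h2 := prob_T_inter p ends a₁ a₂ a₃ Set.univ
  simp only [Set.inter_univ] at h1 h2
  rw [h1, h2, ← Finset.sum_sub_distrib]
  refine Finset.sum_congr rfl fun W _ => ?_
  rw [s3_mul_eq a₁ a₂ W _ (fun h₁ h₂ => by
    simp [mW, fibre_eq_empty_of_mem_mem ends a₁ a₂ a₃ h₁ h₂])]
  unfold mW
  split_ifs <;> ring

omit [LinearOrder R] [IsStrictOrderedRing R] in
/-- `E_Q[σ₃ U_o] = ∑_W s3 W · Su_o W`. -/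
lemma EQ3o_eq (p : E → R) (ends : E → Sym2 V) (o a₁ a₂ a₃ : V) :
    EQ3o p ends o a₁ a₂ a₃ = ∑ W : Finset V, s3 a₁ a₂ W * Su p ends a₁ a₂ a₃ o W := by
  unfold EQ3o
  rw [prob_T'_inter, prob_T'_inter, prob_T_inter, prob_T_inter, ← Finset.sum_add_distrib,
    ← Finset.sum_sub_distrib, ← Finset.sum_sub_distrib]
  refine Finset.sum_congr rfl fun W _ => ?_
  rw [s3_mul_eq a₁ a₂ W _ (fun h₁ h₂ => by
    simp [Su, prob_fibre_inter_eq_zero_of_mem_mem p ends a₁ a₂ a₃ h₁ h₂])]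
  unfold Su
  split_ifs <;> ring

omit [LinearOrder R] [IsStrictOrderedRing R] in
/-- `E_Q[σ_b σ₃ U_o] = ∑_W s3 W · Sbuo W`. -/
lemma EQb3o_eq (p : E → R) (ends : E → Sym2 V) (o a₁ a₂ a₃ b : V) :
    EQb3o p ends o a₁ a₂ a₃ b = ∑ W : Finset V, s3 a₁ a₂ W * Sbuo p ends a₁ a₂ a₃ b o W := by
  unfold EQb3o
  rw [prob_T'_inter, prob_T'_inter, prob_T_inter, prob_T_inter, prob_T_inter, prob_T_inter,
    prob_T'_inter, prob_T'_inter, ← Finset.sum_add_distrib, ← Finset.sum_add_distrib,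
    ← Finset.sum_add_distrib, ← Finset.sum_sub_distrib, ← Finset.sum_sub_distrib,
    ← Finset.sum_sub_distrib, ← Finset.sum_sub_distrib]
  refine Finset.sum_congr rfl fun W _ => ?_
  rw [s3_mul_eq a₁ a₂ W _ (fun h₁ h₂ => by
    simp [Sbuo, prob_fibre_inter_eq_zero_of_mem_mem p ends a₁ a₂ a₃ h₁ h₂])]
  unfold Sbuo
  simp only [Set.inter_comm (connEvent ends a₁ o) (connEvent ends a₁ b),
    Set.inter_comm (connEvent ends a₂ o) (connEvent ends a₁ b),
    Set.inter_comm (connEvent ends a₁ o) (connEvent ends a₂ b),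
    Set.inter_comm (connEvent ends a₂ o) (connEvent ends a₂ b)]
  split_ifs <;> ring

/-- The sum of the per-fibre identities. -/
lemma sum_slack_div_add_btw {p : E → R} (hp : IsProbVec p) (ends : E → Sym2 V)
    (o a₁ a₂ a₃ b : V) :
    (∑ W : Finset V, slack p ends o a₁ a₂ a₃ b W / mW p ends a₁ a₂ a₃ W) +
        btw p ends o a₁ a₂ a₃ b =
      ∑ W : Finset V, (SbF p ends o a₁ a₂ a₃ b W -
          if a₁ ∉ W ∧ a₂ ∉ W then Suu p ends a₁ a₂ a₃ b o W else 0) -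
        (∑ W : Finset V, Ssig p ends a₁ a₂ a₃ b W) * (∑ W : Finset V, SF p ends o a₁ a₂ a₃ W) /
          prob p (avoidAll ends a₂ {a₁}) +
        (∑ W : Finset V, if a₁ ∉ W ∧ a₂ ∉ W then Su p ends a₁ a₂ a₃ b W else 0) *
          (∑ W : Finset V, if a₁ ∉ W ∧ a₂ ∉ W then Su p ends a₁ a₂ a₃ o W else 0) /
          prob p (PDEvent ends a₁ a₂ a₃) := by
  unfold btw fibresA
  rw [Finset.sum_filter, Finset.sum_filter, Finset.sum_filter]
  have h : ∀ W : Finset V, slack p ends o a₁ a₂ a₃ b W / mW p ends a₁ a₂ a₃ W +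
      Ssig p ends a₁ a₂ a₃ b W * SF p ends o a₁ a₂ a₃ W / mW p ends a₁ a₂ a₃ W -
      (if a₁ ∉ W ∧ a₂ ∉ W then
        Su p ends a₁ a₂ a₃ b W * Su p ends a₁ a₂ a₃ o W / mW p ends a₁ a₂ a₃ W else 0) =
      SbF p ends o a₁ a₂ a₃ b W - (if a₁ ∉ W ∧ a₂ ∉ W then Suu p ends a₁ a₂ a₃ b o W else 0) :=
    fun W => slack_div_add hp ends o a₁ a₂ a₃ b W
  have hsum := Finset.sum_congr rfl (fun W (_ : W ∈ (Finset.univ : Finset (Finset V))) => h W)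
  rw [Finset.sum_sub_distrib, Finset.sum_add_distrib] at hsum
  linear_combination hsum

omit [LinearOrder R] [IsStrictOrderedRing R] in
/-- `∑_W SbF W` and `∑_W SF W` expanded. -/
lemma sum_SbF (p : E → R) (ends : E → Sym2 V) (o a₁ a₂ a₃ b : V) :
    ∑ W : Finset V, SbF p ends o a₁ a₂ a₃ b W =
      (∑ W : Finset V, Sbo p ends a₁ a₂ a₃ b o W) +
        gamma p ends o a₁ a₂ a₃ * (∑ W : Finset V, s3 a₁ a₂ W * Ssig p ends a₁ a₂ a₃ b W) -
        ∑ W : Finset V, s3 a₁ a₂ W * Sbuo p ends a₁ a₂ a₃ b o W := by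
  have h : ∀ W : Finset V, SbF p ends o a₁ a₂ a₃ b W = Sbo p ends a₁ a₂ a₃ b o W +
      gamma p ends o a₁ a₂ a₃ * (s3 a₁ a₂ W * Ssig p ends a₁ a₂ a₃ b W) -
      s3 a₁ a₂ W * Sbuo p ends a₁ a₂ a₃ b o W := fun W => by unfold SbF; ring
  simp only [h]
  rw [Finset.sum_sub_distrib, Finset.sum_add_distrib, ← Finset.mul_sum]

omit [LinearOrder R] [IsStrictOrderedRing R] in
/-- `∑_W SF W` expanded. -/
lemma sum_SF (p : E → R) (ends : E → Sym2 V) (o a₁ a₂ a₃ : V) :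
    ∑ W : Finset V, SF p ends o a₁ a₂ a₃ W =
      (∑ W : Finset V, Ssig p ends a₁ a₂ a₃ o W) +
        gamma p ends o a₁ a₂ a₃ * (∑ W : Finset V, s3 a₁ a₂ W * mW p ends a₁ a₂ a₃ W) -
        ∑ W : Finset V, s3 a₁ a₂ W * Su p ends a₁ a₂ a₃ o W := by
  have h : ∀ W : Finset V, SF p ends o a₁ a₂ a₃ W = Ssig p ends a₁ a₂ a₃ o W +
      gamma p ends o a₁ a₂ a₃ * (s3 a₁ a₂ W * mW p ends a₁ a₂ a₃ W) -
      s3 a₁ a₂ W * Su p ends a₁ a₂ a₃ o W := fun W => by unfold SF; ring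
  simp only [h]
  rw [Finset.sum_sub_distrib, Finset.sum_add_distrib, ← Finset.mul_sum]

omit [Fintype V] [DecidableEq V] in
/-- `D_o ≤ D`, so `D = 0` forces `D_o = 0`. -/
lemma Do_eq_zero_of_PD {p : E → R} (hp : IsProbVec p) (ends : E → Sym2 V) (o a₁ a₂ a₃ : V)
    (hD : prob p (PDEvent ends a₁ a₂ a₃) = 0) : Do p ends o a₁ a₂ a₃ = 0 := by
  unfold Do
  have h1 := prob_mono hp (Set.inter_subset_left : PDEvent ends a₁ a₂ a₃ ∩ connEvent ends a₁ o ⊆ _)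
  have h2 := prob_mono hp (Set.inter_subset_left : PDEvent ends a₁ a₂ a₃ ∩ connEvent ends a₂ o ⊆ _)
  rw [hD] at h1 h2
  have := prob_nonneg hp (PDEvent ends a₁ a₂ a₃ ∩ connEvent ends a₁ o)
  have := prob_nonneg hp (PDEvent ends a₁ a₂ a₃ ∩ connEvent ends a₂ o)
  linarith

omit [Fintype V] [DecidableEq V] in
/-- `D ≤ P(Q)`. -/
lemma prob_PD_le_Q {p : E → R} (hp : IsProbVec p) (ends : E → Sym2 V) (a₁ a₂ a₃ : V) :
    prob p (PDEvent ends a₁ a₂ a₃) ≤ prob p (avoidAll ends a₂ {a₁}) := by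
  apply prob_mono hp
  rw [PDEvent, avoidAll_eq_compl']
  exact Set.inter_subset_left

/-- **The a₃-exploration identity**: `Gc = P(PD)·P(Q)·(∑_W slack W / m_W + btw)`. -/
theorem Gc_eq_a3 {p : E → R} (hp : IsProbVec p) (ends : E → Sym2 V) (o a₁ a₂ a₃ b : V) :
    Gc p ends o a₁ a₂ a₃ b =
      prob p (PDEvent ends a₁ a₂ a₃) * prob p (avoidAll ends a₂ {a₁}) *
        ((∑ W : Finset V, slack p ends o a₁ a₂ a₃ b W / mW p ends a₁ a₂ a₃ W) +
          btw p ends o a₁ a₂ a₃ b) := by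
  rw [sum_slack_div_add_btw hp, Finset.sum_sub_distrib, sum_SbF, sum_SF]
  by_cases hD : prob p (PDEvent ends a₁ a₂ a₃) = 0
  · have hDo := Do_eq_zero_of_PD hp ends o a₁ a₂ a₃ hD
    unfold Gc DEF
    rw [hD, hDo]
    ring
  · have hPQ : prob p (avoidAll ends a₂ {a₁}) ≠ 0 := by
      intro h
      apply hD
      have h1 := prob_PD_le_Q hp ends a₁ a₂ a₃
      have h2 := prob_nonneg hp (PDEvent ends a₁ a₂ a₃)
      linarith
    unfold Gc DEF
    rw [EQbo_eq p ends o a₁ a₂ a₃ b, EQb3_eq, EQb3o_eq, EQo_eq p ends o a₁ a₂ a₃, EQ3_eq, EQ3o_eq,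
      PDb_eq, PDbo_eq, gap_eq_sum p ends a₁ a₂ a₃ b, ← Do_eq p ends o a₁ a₂ a₃]
    unfold gamma
    field_simp
    ring

/-- **(HCOV) from (MEANS-a₃)**: `A3Between → HCov`. -/
theorem HCov_of_a3Between {p : E → R} (hp : IsProbVec p) (ends : E → Sym2 V) (o a₁ a₂ a₃ b : V)
    (h : A3Between p ends o a₁ a₂ a₃ b) : HCov p ends o a₁ a₂ a₃ b := by
  unfold HCov
  rw [Gc_eq_a3 hp]
  apply mul_nonneg (mul_nonneg (prob_nonneg hp _) (prob_nonneg hp _))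
  apply add_nonneg _ h
  apply Finset.sum_nonneg
  intro W _
  apply div_nonneg (slack_nonneg p hp ends o a₁ a₂ a₃ b W) (prob_nonneg hp _)

end Assembly

section Closure

variable (R : Type*) [Field R] [LinearOrder R] [IsStrictOrderedRing R]

/-- **(MEANS-a₃) for every finite graph** (the binders of `HCov_all`). -/
def A3Between_all : Prop :=
  ∀ (V E : Type) [Fintype V] [DecidableEq V] [Fintype E] [DecidableEq E]
    (ends : E → Sym2 V) (p : E → R), IsProbVec p →
    ∀ o a₁ a₂ a₃ b : V, a₁ ≠ a₂ → a₁ ≠ a₃ → a₂ ≠ a₃ → o ≠ a₁ → o ≠ a₂ → o ≠ a₃ → o ≠ b →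
      b ≠ a₁ → b ≠ a₂ → b ≠ a₃ → A3Between p ends o a₁ a₂ a₃ b

/-- **(HCOV) for every finite graph from (MEANS-a₃) for every finite graph**: the crux
`HCov_all` is implied by `A3Between_all`. -/
theorem HCov_all_of_a3Between_all (h : A3Between_all R) : HCov_all R := by
  intro V E _ _ _ _ ends p hp o a₁ a₂ a₃ b h1 h2 h3 h4 h5 h6 h7 h8 h9 h10
  exact HCov_of_a3Between hp ends o a₁ a₂ a₃ b
    (h V E ends p hp o a₁ a₂ a₃ b h1 h2 h3 h4 h5 h6 h7 h8 h9 h10)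

end Closure

end A3Fibre

end CovForm

end Summit.Ventures.PercRepro2
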